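import Summits.CriticalPhenomena.CardyFormulaZ2.Theorems.CardyComplexConeParafermionToSLESixFamiliesDefs
import Summits.CriticalPhenomena.CardyFormulaZ2.Theorems.CardyComplexConeParafermionToSLESixFamiliesReduction
import Summits.CriticalPhenomena.CardyFormulaZ2.Theorems.CardyComplexConeParafermionToSLESixFamiliesStubSleSixOfLimitData
import Summits.CriticalPhenomena.CardyFormulaZ2.Theorems.CardyComplexConeParafermionToSLESixFamiliesStubTightFamilies
import HarnessLib

/-!
# The crux `ParafermionToSLESixFamilies` follows from `SlitMartingaleData` ALONE (hypotheses A, B unused)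

Route `CardyComplexCone` (sub-problem `CriticalPhenomena/CardyFormulaZ2`), crux
`Summit.CriticalPhenomena.CardyFormulaZ2.Theses.CardyComplexCone.ParafermionToSLESixFamilies`
(item stmt-CriticalPhenomena-11389), lead c3 (`prover-line-stmt-CriticalPhenomena-11389-c3-0`).

Registered glue for the planner's restatement under the route's kill criterion (7). The crux is
`A → B → C` (`A = WeakHolFamilies`, `B = PrecompactFamilies`, `C = SLESixAllFamilies`, Defs module §0).
This file records, sorry-free and BY NAME, that the whole of `C` — hence the crux, with `A` and `B`
discarded — follows from the single named statement `SlitMartingaleData` of the definitions module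
(Kemppainen–Smirnov limit data + the discrete spin-1/3 slit-observable martingale approximation along
every admissible family), using only LANDED theorems: the κ = 6 continuum step `stub_sleSixOfLimitData`
(p90439), Aizenman–Burchard tightness for families `stub_tightFamilies` (p90862), measurability of the
interface (`measurable_bondInterfaceIn`, `BondInterfaceMeasurability.lean`) and the tree's Prokhorov + uniqueness criterion
`convergesInLawToSLE_of_isTightAlongMesh`. With the landed reduction
`slitMartingaleData_of_percData : PercKSBoxData → PercParaApprox → SlitMartingaleData` (p90407) the crux
is `PercKSBoxData → PercParaApprox → crux` (`parafermionToSLESixFamilies_of_percData`).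

Reading (with `Cruxes/ParafermionToSLESixFamilies/Disproof.lean` §5, `crux_iff_conjecture_of_holoWorld`:
`A ∧ B` hold in every holomorphic world): the typed hypotheses of the crux carry no identification
content, and its conclusion is reached from `SlitMartingaleData` without them; so the honest items
behind #5 are `PercParaApprox` (identification N + I and slit/pin uniformity U, research) and
`PercKSBoxData` (Kemppainen–Smirnov Condition G2 for bond-ℤ² families, classical RSW), not `A → B → C`.
-/

noncomputable section

open scoped Topology NNReal ENNReal BoundedContinuousFunction
open Filter Set MeasureTheory
open Literature.Probability Literature.Probability.LatticeModels Literature.Probability.Percolation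
open Literature.Probability.RandomPlanarGeometry
open scoped Literature.Probability.RandomPlanarGeometry.PathBorel

namespace Summit.CriticalPhenomena.CardyFormulaZ2.Cruxes.ParafermionToSLESixFamilies.CaratheodoryNetSlitUniformity

open Summit.CriticalPhenomena.CardyFormulaZ2.Theses.CardyComplexCone (ParafermionToSLESixFamilies)
-- buildfix lane 2026-08-20: namespace-local alias(es) so that short names made ambiguous by the
-- 2026-08-15 Literature migration (old home vs re-exported new home, both in the import cone) resolve,
-- as in the accepted build, to the OLD home `Literature.Probability.Percolation`. No declaration text changes.
export Literature.Probability.Percolation (bondInterfaceIn bondInterfaceIn_apply)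

/-- Block C of the crux is the named conjecture `SLE6LimitZ2AllDiscretisations` with the six
`ZdDiscretisationFamily` fields unbundled (as in `Disproof.lean` §0). -/
theorem slesixAllFamilies_iff_sle6LimitZ2AllDiscretisations :
    SLESixAllFamilies ↔ Literature.Probability.Percolation.SLE6LimitZ2AllDiscretisations := by
  constructor
  · intro h D E hE
    exact h D E hE.Ω_eq hE.δ_eq hE.tendsto_arcA hE.tendsto_arcB hE.tendsto_zdABEdges
      hE.eventually_isZdAdmissible
  · intro h D E h1 h2 h3 h4 h5 h6
    exact h D E ⟨h1, h2, h3, h4, h5, h6⟩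

/-- **Identification of subsequential limits from `SlitMartingaleData`.** Along an admissible family,
every subsequential weak limit law of the interfaces is the chordal SLE₆ law: `SlitMartingaleData`
supplies the uniformizing map, the Loewner describability, the source clause, the driving convergence
and the martingale approximation, and the landed κ = 6 step `stub_sleSixOfLimitData` concludes. -/
theorem isSLELaw_six_of_slitMartingaleData (hData : SlitMartingaleData)
    {D : DobrushinDomain} {Λ : ℝ → DiscreteDobrushin} (hΛ : ZdDiscretisationFamily D Λ)
    {μ : Measure (CurveClass ℂ)} (hμ : IsProbabilityMeasure μ)
    (hsub : IsSubseqLimitLaw (Ωδ := fun _ => BondConfig (Site 2)) (fun δ ↦ bondInterfaceIn D (Λ δ))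
      (fun _ => Pc) μ) :
    IsSLELaw 6 D μ := by
  haveI := hμ
  obtain ⟨u, hu, hlim⟩ := hsub
  obtain ⟨φ, hφ, hdesc, hsrc, V, hVc, hlaw, hD⟩ := hData D Λ hΛ u hu μ hlim
  exact stub_sleSixOfLimitData D φ hφ μ hdesc hsrc V hVc hlaw hD

/-- **Block C from `SlitMartingaleData`.** Tightness of families (`stub_tightFamilies`), measurability
(`measurable_bondInterfaceIn`),
identification of subsequential limits (`isSLELaw_six_of_slitMartingaleData`) and the tree's
Prokhorov + uniqueness criterion `convergesInLawToSLE_of_isTightAlongMesh` give SLE₆ convergence along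
every discretisation family of every Dobrushin domain. -/
theorem slesixAllFamilies_of_slitMartingaleData : SlitMartingaleData → SLESixAllFamilies := by
  intro hData
  refine slesixAllFamilies_iff_sle6LimitZ2AllDiscretisations.2 fun D Λ hΛ => ?_
  haveI : ∀ δ : ℝ, IsProbabilityMeasure ((fun _ : ℝ => Pc) δ) := fun _ => by
    dsimp only [Pc]; infer_instance
  refine convergesInLawToSLE_of_isTightAlongMesh (κ := 6) (D := D)
    (Y := fun δ ↦ bondInterfaceIn D (Λ δ)) (P := fun _ => Pc) IsSLECurve.map_eq_holds
    (Eventually.of_forall fun δ =>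
      (measurable_bondInterfaceIn D (Λ δ)).aemeasurable)
    (stub_tightFamilies D Λ hΛ) fun μ hμ hsub => ?_
  exact isSLELaw_six_of_slitMartingaleData hData hΛ hμ hsub

/-- **The crux from `SlitMartingaleData` alone** (hypotheses A = `WeakHolFamilies` and
B = `PrecompactFamilies` are introduced and discarded): registered glue for kill criterion (7). -/
theorem parafermionToSLESixFamilies_of_slitMartingaleData : SlitMartingaleData → ParafermionToSLESixFamilies := by
  intro hData _hA _hB
  exact slesixAllFamilies_of_slitMartingaleData hData

/-- **The crux from the two named percolation inputs** `PercKSBoxData` (Kemppainen–Smirnov box data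
for bond-ℤ² families, Condition G2) and `PercParaApprox` (the discrete slit-observable martingale
approximation: identification + slit uniformity), through the landed reduction
`slitMartingaleData_of_percData`; A and B unused. -/
theorem parafermionToSLESixFamilies_of_percData : PercKSBoxData → PercParaApprox → ParafermionToSLESixFamilies :=
  fun hKS hPA => parafermionToSLESixFamilies_of_slitMartingaleData (slitMartingaleData_of_percData hKS hPA)

end Summit.CriticalPhenomena.CardyFormulaZ2.Cruxes.ParafermionToSLESixFamilies.CaratheodoryNetSlitUniformity

end
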